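import Summits.HodgeConjecture.CorCM.Census.OcticTwistFloor
import Summits.HodgeConjecture.CorCM.Census.QuarticTwistHalfParity

/-!
# The octic twist `(ℤ/8 × B, (4,0))`, XXII: NO SCREW PAIR TYPES — the orientation parity and the HALF-PARITY FUNCTIONAL of the pair model

COR-CM (cell `pub-hodgecm2`), count-neutral kernel combinatorics by the binder seat b09 (gen 34; lane COINVARIANT-TWIST / OCTIC RECON), on top of
parts I–II (`act`, `actInv`, `actEquiv`, `transl₂`, `act_cst_cst`, …), part XV (`Census/OcticTwistFloor.lean`) and gen 32ʼs quartic half-parity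
(`QuarticTwistHalfParity`: `fpar`, **`fpar_eq_of_mem_hodge`**; `QuarticTwistModel.par`) BY NAME; the pattern is the quartic file one dimension up.
One bookkeeping definition (`fpar₂`) + theorems; no certificate, no named fact, no `sorry`.
HONEST FRAMING: `HC_CM` is NOT proved, here or anywhere in the tree; nothing here is a period or a headline.

THE MISSING FUNCTIONAL FOR EVEN `|B|`.  The block parities of part XV see only `β − 2` dimensions of `hodge₂` when `|B|` is even (part XXI).
* §1 A SCREW PAIR TYPE is a pair type fixed by an ODD motion (`act true h T = T`).  Without screw pair types, two motions carrying a block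
  representative to the same type have the same parity (`eq_of_act_eq_act`), so **`exists_parity₂`**: there is `c : Ty₂ → 𝔽₂` with
  `c(act e h T) = c(T) + [e]` — the ORIENTATION PARITY of the pair model.  **`eight_dvd_of_screw₂`**: a screw pair type forces `8 ∣ ord h.2`
  (`T.1(b + 2h.2) = T.1(b) − (2h.1 + 1)`, so the order of `2·h.2` is divisible by `4` and that of `h.2` by `8`).
* §2 THE HALF-PARITY FUNCTIONAL **`fpar₂`**: `f_{b₀}(m) = Σ_T [ (T.1(b₀) − T.2(b₀)) ≡ c(T) (mod 2) ]·m(T) mod 2` — the parity of the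
  DIFFERENCE of the two coordinates at the base column `b₀` against the orientation parity.  A diagonal motion keeps the difference and moves the
  column; a swap-twist turns it into `1 −` itself and flips `c`: **`fpar₂_transl₂`** `f_{b₀}((e,h)·m) = f_{b₀ + h.2}(m)`.  It kills the octic pairs
  (`fpar₂_pairVec₂`).  ON `hodge₂` THE BASE COLUMN DOES NOT MATTER (**`fpar₂_eq_of_mem_hodge₂`**): the difference `f_{b₀} − f_{b₁}` is
  `Σ_T m(T)(par T.1 b₀ + par T.2 b₀ + par T.1 b₁ + par T.2 b₁) = Σ_s marg₀(m)(s)(par s b₀ + par s b₁) + Σ_t marg₁(m)(t)(…)`, and each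
  marginal is a quartic Hodge vector, on which such column parities vanish (`sum_par_add_par_eq_zero`, from the quartic `fpar_eq_of_mem_hodge`).
  Hence `fpar₂` is motion-invariant on `hodge₂` (`fpar₂_transl₂_of_mem_hodge₂`), and **`fpar₂_W`**: `f(w_1 ⊗ e_0) = 1` for `|B|` even — while
  `w_1 ⊗ e_0` is invisible to every block parity.  Part XXIII turns this into the law without screw pair types.  All [folklore].

## References
* [Pohlmann1968] H. Pohlmann, Algebraic cycles on abelian varieties of complex multiplication type, Ann. of Math. 88 (1968), Thm 1.
* [Milne1999] J. S. Milne, Lefschetz motives and the Tate conjecture, Compositio Math. 117 (1999), Prop. 2.1, p. 54.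
-/

namespace Summit.HodgeConjecture.CorCM.Census.OcticTwist

open Finset
open Summit.HodgeConjecture.CorCM.Census.QuarticTwist

variable (B : Type) [AddGroup B] [Fintype B] [DecidableEq B]

/-! ## §1 No screw pair types: the orientation parity of the pair model -/

omit [Fintype B] [DecidableEq B] in
/-- **Motions compose**, with parities adding: `act e h ∘ act e' h' = act (e xor e') H` for some `H`. [folklore] -/
theorem exists_act_comp (e e' : Bool) (h h' : ZMod 4 × B) :
    ∃ H : ZMod 4 × B, ∀ T : Ty₂ B, act B e h (act B e' h' T) = act B (xor e e') H T := by
  cases e <;> cases e'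
  · exact ⟨h + h', act_false_false B h h'⟩
  · exact ⟨h + h', act_false_true B h h'⟩
  · exact ⟨h + h', act_true_false B h h'⟩
  · exact ⟨h + h' + (1, 0), act_true_true B h h'⟩

omit [Fintype B] [DecidableEq B] in
/-- The inverse motion has the same parity. [folklore] -/
theorem exists_actInv_eq_act (e : Bool) (h : ZMod 4 × B) : ∃ h' : ZMod 4 × B, ∀ T : Ty₂ B, actInv B e h T = act B e h' T := by
  cases e
  · exact ⟨-h, actInv_false B h⟩
  · exact ⟨-(1, 0) - h, actInv_true B h⟩

omit [Fintype B] [DecidableEq B] in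
/-- **Without screw pair types, two motions with the same effect on a type have the same parity.** [folklore] -/
theorem eq_of_act_eq_act (hns : ∀ (T : Ty₂ B) (h : ZMod 4 × B), act B true h T ≠ T) {e₁ e₂ : Bool} {h₁ h₂ : ZMod 4 × B} {r : Ty₂ B}
    (heq : act B e₁ h₁ r = act B e₂ h₂ r) : e₁ = e₂ := by
  by_contra hne
  obtain ⟨k, hk⟩ := exists_actInv_eq_act B e₂ h₂
  obtain ⟨H, hH⟩ := exists_act_comp B e₂ e₁ k h₁
  have h1 : act B e₂ k (act B e₁ h₁ r) = r := by rw [heq, ← hk, actInv_act]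
  rw [hH] at h1
  have hx : xor e₂ e₁ = true := by
    cases e₁ <;> cases e₂ <;> simp_all
  rw [hx] at h1
  exact hns r H h1

omit [Fintype B] [DecidableEq B] in
/-- **The orientation parity of the pair model**: without screw pair types there is `c : Ty₂ → 𝔽₂` with `c(act e h T) = c(T) + [e]`. [folklore] -/
theorem exists_parity₂ (hns : ∀ (T : Ty₂ B) (h : ZMod 4 × B), act B true h T ≠ T) :
    ∃ c : Ty₂ B → ZMod 2, ∀ (e : Bool) (h : ZMod 4 × B) (T : Ty₂ B), c (act B e h T) = c T + (if e then 1 else 0) := by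
  classical
  have hsel : ∀ T : Ty₂ B, ∃ eh : Bool × (ZMod 4 × B), act B eh.1 eh.2 (Quotient.mk (orbitRel₂ B) T).out = T := fun T => by
    have h' : (orbitRel₂ B).r (Quotient.mk (orbitRel₂ B) T).out T := Quotient.exact (Quotient.out_eq _)
    obtain ⟨e, h, he⟩ := h'
    exact ⟨(e, h), he⟩
  choose sel hsel using hsel
  refine ⟨fun T => if (sel T).1 then 1 else 0, fun e h T => ?_⟩
  have hq : (Quotient.mk (orbitRel₂ B) T : Orb₂ B) = Quotient.mk (orbitRel₂ B) (act B e h T) := Quotient.sound ⟨e, h, rfl⟩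
  obtain ⟨r, hr⟩ : ∃ r, (Quotient.mk (orbitRel₂ B) T).out = r := ⟨_, rfl⟩
  have h1 : act B (sel T).1 (sel T).2 r = T := by rw [← hr]; exact hsel T
  have h2 : act B (sel (act B e h T)).1 (sel (act B e h T)).2 r = act B e h T := by rw [← hr, hq]; exact hsel (act B e h T)
  obtain ⟨H, hH⟩ := exists_act_comp B e (sel T).1 h (sel T).2
  have h3 : act B e h T = act B (xor e (sel T).1) H r := by
    have h' := hH r
    rw [h1] at h'
    exact h'
  have he := eq_of_act_eq_act B hns (h2.trans h3)
  show (if (sel (act B e h T)).1 then (1 : ZMod 2) else 0) = (if (sel T).1 then 1 else 0) + (if e then 1 else 0)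
  rw [he]
  cases e <;> cases (sel T).1 <;> decide

omit [DecidableEq B] in
/-- **A screw pair type forces `8 ∣ ord t`**: if `act true h T = T` then `T.1 (b + 2·h.2) = T.1 b − (2h.1 + 1)`, so the order of `2·h.2` is
divisible by `4` and the order of `h.2` by `8`. [folklore] -/
theorem eight_dvd_of_screw₂ {h : ZMod 4 × B} {T : Ty₂ B} (hfix : act B true h T = T) : 8 ∣ addOrderOf h.2 := by
  obtain ⟨s₀, s₁⟩ := T
  rw [act_true] at hfix
  have h1 : tw B h (tw B (1, 0) s₁) = s₀ := (Prod.ext_iff.mp hfix).1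
  have h2 : tw B h s₀ = s₁ := (Prod.ext_iff.mp hfix).2
  rw [← h2, tw_tw, tw_tw] at h1
  -- the step: `s₀ (b + (h.2 + h.2)) + (h.1 + 1 + h.1) = s₀ b`
  have step : ∀ b : B, s₀ (b + (h.2 + h.2)) = s₀ b - (h.1 + 1 + h.1) := by
    intro b
    have e := congrFun h1 b
    simp only [tw, Prod.snd_add, Prod.fst_add, add_zero] at e
    rw [← e]
    abel
  obtain ⟨b₀⟩ : Nonempty B := ⟨h.2⟩
  have iter : ∀ n : ℕ, s₀ (b₀ + n • (h.2 + h.2)) = s₀ b₀ - n • (h.1 + 1 + h.1) := by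
    intro n
    induction n with
    | zero => simp
    | succ n ih => rw [succ_nsmul, ← add_assoc, step, ih, succ_nsmul]; abel
  -- at `n = ord (2·h.2)`: `n • (2h.1 + 1) = 0` in `ℤ/4`, so `4 ∣ n`
  set n := addOrderOf (h.2 + h.2) with hn
  have e := iter n
  rw [addOrderOf_nsmul_eq_zero, add_zero] at e
  have e' : (n : ZMod 4) * (h.1 + 1 + h.1) = 0 := by
    have := sub_eq_self.mp e.symm
    rwa [nsmul_eq_mul] at this
  have hunit : (h.1 + 1 + h.1) * (h.1 + 1 + h.1) = 1 := by
    have key : ∀ x : ZMod 4, (x + 1 + x) * (x + 1 + x) = 1 := by decide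
    exact key h.1
  have h4n : 4 ∣ n := by
    have : (n : ZMod 4) = 0 := by
      have := congrArg (· * (h.1 + 1 + h.1)) e'
      simpa only [mul_assoc, hunit, mul_one, zero_mul] using this
    exact (ZMod.natCast_eq_zero_iff _ _).mp this
  -- `ord h.2 = 2 · ord (2·h.2)`
  set N := addOrderOf h.2 with hN
  have hNpos : 0 < N := addOrderOf_pos h.2
  have hdvd1 : n ∣ N := by
    refine addOrderOf_dvd_iff_nsmul_eq_zero.mpr ?_
    rw [← two_nsmul, ← mul_nsmul, mul_nsmul', hN, addOrderOf_nsmul_eq_zero, nsmul_zero]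
  have hdvd2 : N ∣ 2 * n := by
    refine addOrderOf_dvd_iff_nsmul_eq_zero.mpr ?_
    rw [mul_nsmul, two_nsmul, hn, addOrderOf_nsmul_eq_zero]
  have hne : N ≠ n := by
    intro hNn
    -- then `(N/2) • (h.2 + h.2) = N • h.2 = 0`, so `n ∣ N/2 < n`
    have h2N : 2 ∣ N := by
      have : 4 ∣ N := hNn ▸ h4n
      exact dvd_trans ⟨2, rfl⟩ this
    obtain ⟨M, hM⟩ := h2N
    have hM0 : M • (h.2 + h.2) = 0 := by
      rw [← two_nsmul, ← mul_nsmul, ← hM, hN, addOrderOf_nsmul_eq_zero]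
    have hnM : n ∣ M := addOrderOf_dvd_iff_nsmul_eq_zero.mpr hM0
    have hMpos : 0 < M := by omega
    have := Nat.le_of_dvd hMpos hnM
    omega
  obtain ⟨k, hk⟩ := hdvd1
  obtain ⟨l, hl⟩ := hdvd2
  have hnpos : 0 < n := addOrderOf_pos _
  -- `N = n·k`, `2n = N·l` ⇒ `k·l = 2`, `k ≠ 1` ⇒ `k = 2`
  have hkl : k * l = 2 := by
    have : n * (k * l) = n * 2 := by rw [← mul_assoc, ← hk, ← hl, mul_comm]
    exact Nat.eq_of_mul_eq_mul_left hnpos this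
  have hk2 : k = 2 := by
    have hk1 : k ≠ 1 := fun h1' => hne (by rw [hk, h1', mul_one])
    have hkd : k ∣ 2 := ⟨l, hkl.symm⟩
    have hkle : k ≤ 2 := Nat.le_of_dvd (by norm_num) hkd
    interval_cases k
    · simp at hkl
    · exact absurd rfl hk1
    · rfl
  rw [hk, hk2]
  obtain ⟨q, hq⟩ := h4n
  exact ⟨q, by rw [hq]; ring⟩

/-! ## §2 The half-parity functional -/

/-- **The half-parity functional of the pair model** `f_{b₀}(m) = Σ_T [ (T.1(b₀) − T.2(b₀)) ≡ c(T) (mod 2) ]·m(T) mod 2`. [folklore] -/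
noncomputable def fpar₂ (b₀ : B) (c : Ty₂ B → ZMod 2) : (Ty₂ B → ℤ) →ₗ[ℤ] ZMod 2 where
  toFun m := ∑ T, (m T : ZMod 2) * (if par (T.1 b₀ - T.2 b₀) = c T then 1 else 0)
  map_add' m m' := by
    simp only [Pi.add_apply, Int.cast_add, add_mul, Finset.sum_add_distrib]
  map_smul' a m := by
    simp only [Pi.smul_apply, smul_eq_mul, Int.cast_mul, RingHom.id_apply, Finset.mul_sum, zsmul_eq_mul, mul_assoc]

omit [AddGroup B] in
/-- `fpar₂` evaluated. [folklore] -/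
theorem fpar₂_apply (b₀ : B) (c : Ty₂ B → ZMod 2) (m : Ty₂ B → ℤ) :
    fpar₂ B b₀ c m = ∑ T, (m T : ZMod 2) * (if par (T.1 b₀ - T.2 b₀) = c T then 1 else 0) := rfl

omit [AddGroup B] in
/-- `fpar₂` of a unit vector. [folklore] -/
theorem fpar₂_single (b₀ : B) (c : Ty₂ B → ZMod 2) (T : Ty₂ B) (a : ℤ) :
    fpar₂ B b₀ c (Pi.single T a) = (a : ZMod 2) * (if par (T.1 b₀ - T.2 b₀) = c T then 1 else 0) := by
  classical
  rw [fpar₂_apply, Finset.sum_eq_single T]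
  · rw [Pi.single_eq_same]
  · intro T' _ hT'
    rw [Pi.single_eq_of_ne hT', Int.cast_zero, zero_mul]
  · intro h
    exact absurd (mem_univ T) h

/-- **`fpar₂` kills the octic pairs** (`(2,0)` is an even motion and shifts both coordinates by `2`). [folklore] -/
theorem fpar₂_pairVec₂ {c : Ty₂ B → ZMod 2} (hc : ∀ (e : Bool) (h : ZMod 4 × B) (T : Ty₂ B), c (act B e h T) = c T + (if e then 1 else 0))
    (b₀ : B) (T : Ty₂ B) : fpar₂ B b₀ c (pairVec₂ B T) = 0 := by
  unfold pairVec₂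
  have hact : act B false (2, 0) T = (T.1 + 2, T.2 + 2) := by
    rw [act_false]
    show (tw B (2, 0) T.1, tw B (2, 0) T.2) = _
    rw [tw_two_zero, tw_two_zero]
  have hcT : c (T.1 + 2, T.2 + 2) = c T := by
    rw [← hact, hc]
    simp only [Bool.false_eq_true, if_false, add_zero]
  have hdiff : (T.1 + 2) b₀ - (T.2 + 2) b₀ = T.1 b₀ - T.2 b₀ := by
    simp only [Pi.add_apply]
    ring
  have e4 : ∀ x : ZMod 2, x + x = 0 := by decide
  rw [map_add, fpar₂_single, fpar₂_single, Int.cast_one, one_mul, one_mul]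
  rw [show ((T.1 + 2, T.2 + 2) : Ty₂ B).1 = T.1 + 2 from rfl, show ((T.1 + 2, T.2 + 2) : Ty₂ B).2 = T.2 + 2 from rfl, hdiff, hcT]
  exact e4 _

/-- **A motion moves the base column**: `f_{b₀}((e,h)·m) = f_{b₀ + h.2}(m)` (a diagonal motion keeps the coordinate difference, a swap-twist
replaces it by `1 −` itself and flips `c`). [folklore] -/
theorem fpar₂_transl₂ {c : Ty₂ B → ZMod 2} (hc : ∀ (e : Bool) (h : ZMod 4 × B) (T : Ty₂ B), c (act B e h T) = c T + (if e then 1 else 0))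
    (b₀ : B) (e : Bool) (h : ZMod 4 × B) (m : Ty₂ B → ℤ) : fpar₂ B b₀ c (transl₂ B e h m) = fpar₂ B (b₀ + h.2) c m := by
  rw [fpar₂_apply, fpar₂_apply]
  symm
  refine Fintype.sum_equiv (actEquiv B e h) _ _ fun T => ?_
  have e1 : (actEquiv B e h) T = act B e h T := rfl
  have e2 : transl₂ B e h m (act B e h T) = m T := by
    show m (actInv B e h (act B e h T)) = m T
    rw [actInv_act]
  rw [e1, e2, hc]
  congr 1
  have key : ∀ (x : ZMod 4) (y : ZMod 2), (if par x = y then (1 : ZMod 2) else 0) = if par (-x + 1) = y + 1 then 1 else 0 := by decide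
  cases e
  · rw [act_false]
    simp only [Bool.false_eq_true, if_false, add_zero]
    congr 2
    show par (T.1 (b₀ + h.2) - T.2 (b₀ + h.2)) = par ((T.1 (b₀ + h.2) + h.1) - (T.2 (b₀ + h.2) + h.1))
    congr 1
    ring
  · rw [act_true]
    simp only [if_true]
    rw [key]
    congr 2
    show par (-(T.1 (b₀ + h.2) - T.2 (b₀ + h.2)) + 1) = par ((T.2 (b₀ + h.2 + 0) + 1 + h.1) - (T.1 (b₀ + h.2) + h.1))
    rw [add_zero]
    congr 1
    ring

omit [AddGroup B] in
/-- Column parities vanish on quartic Hodge vectors: `Σ_s v(s)·(par s(b₀) + par s(b₁)) ≡ 0` (the quartic `fpar_eq_of_mem_hodge` with the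
zero orientation). [folklore] -/
theorem sum_par_add_par_eq_zero {v : Ty B → ℤ} (hv : v ∈ hodge B) (b₀ b₁ : B) :
    ∑ s, (v s : ZMod 2) * (par (s b₀) + par (s b₁)) = 0 := by
  have h := fpar_eq_of_mem_hodge B (fun _ => (0 : ZMod 2)) b₀ b₁ hv
  have e : fpar B b₀ (fun _ => 0) v - fpar B b₁ (fun _ => 0) v = ∑ s, (v s : ZMod 2) * (par (s b₀) + par (s b₁)) := by
    show ∑ s, (v s : ZMod 2) * (if par (s b₀) = 0 then 1 else 0) - ∑ s, (v s : ZMod 2) * (if par (s b₁) = 0 then 1 else 0) = _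
    rw [← Finset.sum_sub_distrib]
    refine Finset.sum_congr rfl fun s _ => ?_
    rw [← mul_sub]
    congr 1
    have key : ∀ x y : ZMod 2, ((if x = 0 then (1 : ZMod 2) else 0) - if y = 0 then 1 else 0) = x + y := by decide
    exact key _ _
  rw [← e, h, sub_self]

omit [AddGroup B] in
/-- **ON `hodge₂` THE BASE COLUMN DOES NOT MATTER**: `f_{b₀}(m) = f_{b₁}(m)` for `m ∈ hodge₂` (both marginals are quartic Hodge vectors). [folklore] -/
theorem fpar₂_eq_of_mem_hodge₂ (c : Ty₂ B → ZMod 2) (b₀ b₁ : B) {m : Ty₂ B → ℤ} (hm : m ∈ hodge₂ B) :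
    fpar₂ B b₀ c m = fpar₂ B b₁ c m := by
  rw [mem_hodge₂_iff] at hm
  rw [← sub_eq_zero, fpar₂_apply, fpar₂_apply, ← Finset.sum_sub_distrib]
  have key : ∀ (x₀ y₀ x₁ y₁ : ZMod 4) (cc : ZMod 2),
      ((if par (x₀ - y₀) = cc then (1 : ZMod 2) else 0) - if par (x₁ - y₁) = cc then 1 else 0)
        = (par x₀ + par x₁) + (par y₀ + par y₁) := by
    intro x₀ y₀ x₁ y₁ cc
    have k2 : ∀ (a b cc : ZMod 2), ((if a = cc then (1 : ZMod 2) else 0) - if b = cc then 1 else 0) = a + b := by decide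
    have neg2 : ∀ a : ZMod 2, -a = a := by decide
    rw [k2, map_sub, map_sub, sub_eq_add_neg, sub_eq_add_neg, neg2, neg2]
    abel
  have e : ∀ T : Ty₂ B, (m T : ZMod 2) * (if par (T.1 b₀ - T.2 b₀) = c T then 1 else 0)
      - (m T : ZMod 2) * (if par (T.1 b₁ - T.2 b₁) = c T then 1 else 0)
      = (m T : ZMod 2) * (par (T.1 b₀) + par (T.1 b₁)) + (m T : ZMod 2) * (par (T.2 b₀) + par (T.2 b₁)) := by
    intro T
    rw [← mul_sub, key, mul_add]
  rw [Finset.sum_congr rfl fun T _ => e T, Finset.sum_add_distrib]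
  -- the two sums are column parities of the marginals
  have h0 : ∑ T : Ty₂ B, (m T : ZMod 2) * (par (T.1 b₀) + par (T.1 b₁)) = ∑ s, (marg₀ B m s : ZMod 2) * (par (s b₀) + par (s b₁)) := by
    rw [Fintype.sum_prod_type]
    refine Finset.sum_congr rfl fun s _ => ?_
    rw [marg₀_apply, Int.cast_sum, Finset.sum_mul]
  have h1 : ∑ T : Ty₂ B, (m T : ZMod 2) * (par (T.2 b₀) + par (T.2 b₁)) = ∑ t, (marg₁ B m t : ZMod 2) * (par (t b₀) + par (t b₁)) := by
    rw [Fintype.sum_prod_type, Finset.sum_comm]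
    refine Finset.sum_congr rfl fun t _ => ?_
    rw [marg₁_apply, Int.cast_sum, Finset.sum_mul]
  rw [h0, h1, sum_par_add_par_eq_zero B hm.1, sum_par_add_par_eq_zero B hm.2, add_zero]

/-- **`fpar₂` is motion-invariant on `hodge₂`.** [folklore] -/
theorem fpar₂_transl₂_of_mem_hodge₂ {c : Ty₂ B → ZMod 2}
    (hc : ∀ (e : Bool) (h : ZMod 4 × B) (T : Ty₂ B), c (act B e h T) = c T + (if e then 1 else 0)) (b₀ : B)
    (e : Bool) (h : ZMod 4 × B) {m : Ty₂ B → ℤ} (hm : m ∈ hodge₂ B) : fpar₂ B b₀ c (transl₂ B e h m) = fpar₂ B b₀ c m := by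
  rw [fpar₂_transl₂ B hc, fpar₂_eq_of_mem_hodge₂ B c (b₀ + h.2) b₀ hm]

/-- **`f(w_1 ⊗ e_0) = 1` for `|B|` even** (the Weil lift is invisible to every block parity there). [folklore] -/
theorem fpar₂_W {c : Ty₂ B → ZMod 2} (hc : ∀ (e : Bool) (h : ZMod 4 × B) (T : Ty₂ B), c (act B e h T) = c T + (if e then 1 else 0))
    (hev : Even (Fintype.card B)) (b₀ : B) : fpar₂ B b₀ c (tens B (Wvec B 1) (Pi.single (cst B 0) 1)) = 1 := by
  -- the orientation parities of the three kinds of pair types involved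
  have hc1 : c (cst B 1, cst B 0) = c (cst B 0, cst B 0) + 1 := by
    have h := hc true 0 (cst B 0, cst B 0)
    rw [act_cst_cst] at h
    simp only [if_true, Prod.fst_zero, add_zero, zero_add] at h
    exact h
  have hca : ∀ b : B, c (atom B 1 b (-1), cst B 0) = c (atom B 1 b₀ (-1), cst B 0) := by
    intro b
    have h := hc false (0, -b₀ + b) (atom B 1 b (-1), cst B 0)
    rw [act_false] at h
    have e : tw₂ B ((0 : ZMod 4), -b₀ + b) (atom B 1 b (-1), cst B 0) = (atom B 1 b₀ (-1), cst B 0) := by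
      show (tw B (0, -b₀ + b) (atom B 1 b (-1)), tw B (0, -b₀ + b) (cst B 0)) = _
      rw [tw_atom, tw_cst, add_zero, add_zero, sub_neg_add_self]
    rw [e] at h
    simp only [Bool.false_eq_true, if_false, add_zero] at h
    exact h.symm
  obtain ⟨κ, hκ⟩ : ∃ κ, c (atom B 1 b₀ (-1), cst B 0) = κ := ⟨_, rfl⟩
  obtain ⟨κ₀, hκ₀⟩ : ∃ κ₀, c (cst B 0, cst B 0) = κ₀ := ⟨_, rfl⟩
  -- expand the Weil lift in unit vectors
  unfold Wvec
  rw [show (1 : ZMod 4) - 1 = 0 by decide, tens_sub_left, tens_sub_left, tens_smul_left, tens_sum_left]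
  simp only [← single_eq_tens]
  rw [map_sub, map_sub, map_smul, map_sum]
  have v0 : fpar₂ B b₀ c (Pi.single (cst B 0, cst B 0) 1) = if par (0 : ZMod 4) = κ₀ then 1 else 0 := by
    rw [fpar₂_single, Int.cast_one, one_mul, hκ₀]
    show (if par (cst B 0 b₀ - cst B 0 b₀) = κ₀ then (1 : ZMod 2) else 0) = _
    simp only [cst, sub_self]
  have v1 : fpar₂ B b₀ c (Pi.single (cst B 1, cst B 0) 1) = if par (1 : ZMod 4) = κ₀ + 1 then 1 else 0 := by
    rw [fpar₂_single, Int.cast_one, one_mul, hc1, hκ₀]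
    show (if par (cst B 1 b₀ - cst B 0 b₀) = κ₀ + 1 then (1 : ZMod 2) else 0) = _
    simp only [cst, sub_zero]
  have va : ∀ b : B, fpar₂ B b₀ c (Pi.single (atom B 1 b (-1), cst B 0) 1)
      = if b₀ = b then (if par (0 : ZMod 4) = κ then 1 else 0) else (if par (1 : ZMod 4) = κ then 1 else 0) := by
    intro b
    rw [fpar₂_single, Int.cast_one, one_mul, hca b, hκ]
    show (if par (atom B 1 b (-1) b₀ - cst B 0 b₀) = κ then (1 : ZMod 2) else 0) = _
    rw [atom_apply]
    simp only [cst, sub_zero]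
    by_cases h : b₀ = b
    · rw [if_pos h, if_pos h, show (1 : ZMod 4) + -1 = 0 by decide]
    · rw [if_neg h, if_neg h]
  have vsum : ∑ b, fpar₂ B b₀ c (Pi.single (atom B 1 b (-1), cst B 0) 1)
      = (if par (0 : ZMod 4) = κ then 1 else 0) + (Fintype.card B - 1) • (if par (1 : ZMod 4) = κ then (1 : ZMod 2) else 0) := by
    rw [Finset.sum_congr rfl fun b _ => va b, ← Finset.add_sum_erase _ _ (mem_univ b₀), if_pos rfl,
      Finset.sum_congr rfl fun b hb => if_neg (Ne.symm (ne_of_mem_erase hb)), Finset.sum_const,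
      Finset.card_erase_of_mem (mem_univ b₀), card_univ]
  have hpos : 1 ≤ Fintype.card B := Fintype.card_pos_iff.mpr ⟨b₀⟩
  obtain ⟨k, hk⟩ := hev
  have hn0 : ((Fintype.card B : ℕ) : ZMod 2) = 0 := by
    rw [hk, Nat.cast_add]
    have e : ∀ x : ZMod 2, x + x = 0 := by decide
    exact e _
  have hn1 : ((Fintype.card B - 1 : ℕ) : ZMod 2) = 1 := by
    rw [show Fintype.card B - 1 = 2 * (k - 1) + 1 by omega, Nat.cast_add, Nat.cast_mul, Nat.cast_one,
      show ((2 : ℕ) : ZMod 2) = 0 by decide, zero_mul, zero_add]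
  rw [vsum, v1, v0, zsmul_eq_mul, nsmul_eq_mul, hn1, one_mul, Int.cast_sub, Int.cast_one, Int.cast_natCast, hn0]
  have key : ∀ κ κ₀ : ZMod 2, (if par (0 : ZMod 4) = κ then (1 : ZMod 2) else 0) + (if par (1 : ZMod 4) = κ then 1 else 0)
      - (0 - 1) * (if par (1 : ZMod 4) = κ₀ + 1 then 1 else 0) - (if par (0 : ZMod 4) = κ₀ then 1 else 0) = 1 := by decide
  exact key κ κ₀

end Summit.HodgeConjecture.CorCM.Census.OcticTwist
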